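import Mathlib
import Summits.KontsevichZagierPeriods.Zeta5Search.Families.SectorBounds
import HarnessLib

/-!
# ζ(5) search — Families: BOUNDEDNESS of products of powers of point differences on the simplex

HONEST FRAMING: systematic search; no irrationality claim unless certified.  This file contains NO statement about
zeta values (seat P2, Families layer).  It is the boundedness companion of the integrability criterion
`EdgeFamily.integrableOn_powProd_iff_crit` (F24): for an edge family `E` with real exponents `c`, the function
`powProd E c t = ∏_i (pt t (hi i) − pt t (lo i))^{c_i}` is BOUNDED on the open simplex as soon as every run `R` of
consecutive gaps carries a non-negative exponent sum, `Σ_{i : span i ⊆ R} c_i ≥ 0`, i.e. `|R| ≤ blockSum E c R`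
(`powProd_le_Kup_of_runs`; the bound is the explicit sector constant `Kup ℓ c` of `Families/SectorBounds.lean`).
Proof: on a Hepp sector the comparison `powProd ≤ Kup · ∏_w g_w^{A_π(w)}` (F22) reduces the claim to
`∏_k x_k^{A_k} ≤ 1` for sorted gaps `0 < x_0 ≤ ⋯ ≤ x_ℓ ≤ 1`, which is ABEL SUMMATION in logarithms
(`abel_sum_nonpos`): the partial sums `Σ_{k≤j} A_k = blockSum(lowGaps π j) − (j+1)` are `≥ 0` by the propagation of
the run condition to all gap sets (`card_le_blockSum_of_runs`, same splitting as `blockSum_pos_of_crit`).  This is the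
input for the growth constants of general exponent rays (`Families/RayGrowth.lean`).  Standard axioms only.
-/

noncomputable section

open MeasureTheory Set Finset

namespace Summit.KontsevichZagierPeriods.Zeta5Search.Families.Cellular

variable {ℓ : ℕ} {ι : Type*} (E : EdgeFamily ℓ ι)

/-! ### Abel summation: a monotone non-positive weight against non-negative partial sums -/

/-- ABEL SUMMATION INEQUALITY: if `y_0 ≤ y_1 ≤ ⋯ ≤ y_{n−1} ≤ 0` and all partial sums `Σ_{k ≤ j} A_k` (`j < n`) are
`≥ 0`, then `Σ_{k<n} y_k A_k ≤ 0`. -/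
theorem abel_sum_nonpos {n : ℕ} (A y : ℕ → ℝ) (hS : ∀ j < n, 0 ≤ ∑ k ∈ Finset.range (j + 1), A k)
    (hy : ∀ k, k + 1 < n → y k ≤ y (k + 1)) (hyn : ∀ k < n, y k ≤ 0) :
    ∑ k ∈ Finset.range n, y k * A k ≤ 0 := by
  rcases Nat.eq_zero_or_pos n with rfl | hn
  · simp
  have h := Finset.sum_range_by_parts y A n
  simp only [smul_eq_mul] at h
  rw [h]
  have h1 : y (n - 1) * ∑ i ∈ Finset.range n, A i ≤ 0 := by
    have hS' := hS (n - 1) (by omega)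
    rw [Nat.sub_add_cancel hn] at hS'
    exact mul_nonpos_iff.2 (Or.inr ⟨hyn _ (by omega), hS'⟩)
  have h2 : 0 ≤ ∑ i ∈ Finset.range (n - 1), (y (i + 1) - y i) * ∑ j ∈ Finset.range (i + 1), A j :=
    Finset.sum_nonneg fun i hi => by
      have hi' := Finset.mem_range.1 hi
      exact mul_nonneg (sub_nonneg.2 (hy i (by omega))) (hS i (by omega))
  linarith

/-- Every gap of a point of the open simplex is at most `1` (the gaps are positive and sum to `1`). -/
theorem gapN_le_one {t : Fin ℓ → ℝ} (ht : t ∈ openSimplex ℓ) (w : Fin (ℓ + 1)) : gapN t w ≤ 1 := by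
  have hpos := (mem_openSimplex_iff_gapN t).1 ht
  calc gapN t w ≤ ∑ w' ∈ Finset.range (ℓ + 1), gapN t w' :=
        Finset.single_le_sum (f := fun w' => gapN t w')
          (fun w' hw' => (hpos ⟨w', Finset.mem_range.1 hw'⟩).le) (Finset.mem_range.2 w.isLt)
    _ = 1 := sum_gapN t

namespace EdgeFamily

/-! ### Propagation of the run condition `|R| ≤ blockSum R` to all gap sets -/

/-- If `|R| ≤ blockSum E c R` (i.e. `Σ_{span ⊆ R} c ≥ 0`) for every RUN `R` of consecutive gaps, then the same holds
for every non-empty set of gaps (split a non-run at a missing gap: edge spans are intervals). -/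
theorem card_le_blockSum_of_runs [Fintype ι] {c : ι → ℝ}
    (hc : ∀ p q : ℕ, p < q → q ≤ ℓ + 1 → ((q - p : ℕ) : ℝ) ≤ E.blockSum c (gapRun ℓ p q)) :
    ∀ n : ℕ, ∀ L : Finset (Fin (ℓ + 1)), L.card = n → L.Nonempty → (L.card : ℝ) ≤ E.blockSum c L := by
  -- adapted from `blockSum_pos_of_crit` (Families/EdgePowers.lean)
  classical
  intro n
  induction n using Nat.strong_induction_on with
  | _ n ih =>
    intro L hLn hne
    set p : ℕ := (L.min' hne).val with hp
    set q : ℕ := (L.max' hne).val + 1 with hq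
    have hsub : L ⊆ gapRun ℓ p q := by
      intro w hw
      rw [mem_gapRun]
      exact ⟨Fin.le_def.1 (L.min'_le w hw), Nat.lt_succ_of_le (Fin.le_def.1 (L.le_max' w hw))⟩
    by_cases hrun : gapRun ℓ p q ⊆ L
    · have hL : L = gapRun ℓ p q := Finset.Subset.antisymm hsub hrun
      have hpq : p < q := by
        have := Fin.le_def.1 (L.min'_le _ (L.max'_mem hne)); omega
      have hq' : q ≤ ℓ + 1 := by have := (L.max' hne).isLt; omega
      rw [hL, card_gapRun p q hq']
      exact hc p q hpq hq'
    · obtain ⟨w0, hw0r, hw0L⟩ := Finset.not_subset.1 hrun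
      set L1 := L.filter (fun w => w.val < w0.val) with hL1
      set L2 := L.filter (fun w => ¬ w.val < w0.val) with hL2
      have hmin1 : L.min' hne ∈ L1 := by
        rw [hL1, Finset.mem_filter]
        refine ⟨L.min'_mem hne, ?_⟩
        have h1 : p ≤ w0.val := ((mem_gapRun p q w0).1 hw0r).1
        have h2 : (L.min' hne).val ≠ w0.val := fun h => hw0L ((Fin.ext h) ▸ L.min'_mem hne)
        omega
      have hmax2 : L.max' hne ∈ L2 := by
        rw [hL2, Finset.mem_filter]
        refine ⟨L.max'_mem hne, ?_⟩
        have h1 : w0.val < q := ((mem_gapRun p q w0).1 hw0r).2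
        omega
      have hne1 : L1.Nonempty := ⟨_, hmin1⟩
      have hne2 : L2.Nonempty := ⟨_, hmax2⟩
      have hdisj : Disjoint L1 L2 := by
        rw [hL1, hL2]; exact Finset.disjoint_filter_filter_not L L fun w => w.val < w0.val
      have hunion : L1 ∪ L2 = L := by rw [hL1, hL2]; exact Finset.filter_union_filter_not_eq _ L
      have hcardsum : L1.card + L2.card = L.card := by rw [← Finset.card_union_of_disjoint hdisj, hunion]
      have hlt1 : L1.card < n := by have := hne2.card_pos; omega
      have hlt2 : L2.card < n := by have := hne1.card_pos; omega
      have h1 := ih L1.card hlt1 L1 rfl hne1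
      have h2 := ih L2.card hlt2 L2 rfl hne2
      have hsplit : E.blockSum c L = E.blockSum c L1 + E.blockSum c L2 := by
        unfold blockSum
        have hfilt : (univ.filter fun i => E.span i ⊆ L) =
            (univ.filter fun i => E.span i ⊆ L1) ∪ (univ.filter fun i => E.span i ⊆ L2) := by
          ext i
          simp only [Finset.mem_filter, Finset.mem_univ, true_and, Finset.mem_union]
          exact E.span_subset_split L w0 hw0L i
        have hdisj' : Disjoint (univ.filter fun i => E.span i ⊆ L1) (univ.filter fun i => E.span i ⊆ L2) := by
          rw [Finset.disjoint_filter]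
          intro i _ h1' h2'
          obtain ⟨w, hw⟩ := E.span_nonempty i
          exact Finset.disjoint_left.1 hdisj (h1' hw) (h2' hw)
        rw [hfilt, Finset.sum_union hdisj', ← hcardsum]
        push_cast
        ring
      rw [hsplit, ← hcardsum]
      push_cast
      exact add_le_add h1 h2

/-! ### Boundedness on a Hepp sector -/

variable (π : Equiv.Perm (Fin (ℓ + 1)))

/-- On a sector with sorted gaps `0 < g_{π 0} ≤ ⋯ ≤ g_{π ℓ} ≤ 1`, the sector monomial `∏_w g_w^{A_π(w)}` is at most `1`
as soon as the rank-ordered partial sums `Σ_{k ≤ j} A_π(π k)` are non-negative (Abel summation in logarithms). -/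
theorem aggMono_le_one [Fintype ι] (c : ι → ℝ) {g : Fin (ℓ + 1) → ℝ} (hs : Sorted π g) (hg : ∀ w, 0 < g w)
    (hg1 : ∀ w, g w ≤ 1)
    (hS : ∀ j : Fin (ℓ + 1), 0 ≤ ∑ k : Fin (ℓ + 1), (if k ≤ j then E.aggExp π c (π k) else 0)) :
    E.aggMono π c g ≤ 1 := by
  classical
  unfold aggMono
  rw [← Equiv.prod_comp π (fun w => g w ^ E.aggExp π c w)]
  have hfac : ∀ k, g (π k) ^ E.aggExp π c (π k) = Real.exp (Real.log (g (π k)) * E.aggExp π c (π k)) :=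
    fun k => Real.rpow_def_of_pos (hg _) _
  simp only [hfac, ← Real.exp_sum]
  rw [Real.exp_le_one_iff]
  -- pass to `ℕ`-indexed sequences and apply Abel summation
  set y : ℕ → ℝ := fun k => if h : k < ℓ + 1 then Real.log (g (π ⟨k, h⟩)) else 0 with hy
  set A : ℕ → ℝ := fun k => if h : k < ℓ + 1 then E.aggExp π c (π ⟨k, h⟩) else 0 with hA
  have hsum : ∑ k : Fin (ℓ + 1), Real.log (g (π k)) * E.aggExp π c (π k) =
      ∑ k ∈ Finset.range (ℓ + 1), y k * A k := by
    rw [← Fin.sum_univ_eq_sum_range (fun k => y k * A k)]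
    refine Finset.sum_congr rfl fun k _ => ?_
    have hk : (k : ℕ) < ℓ + 1 := k.isLt
    simp only [hy, hA, hk, dif_pos, Fin.eta]
  rw [hsum]
  refine abel_sum_nonpos A y (fun j hj => ?_) (fun k hk => ?_) (fun k hk => ?_)
  · -- partial sums
    have h := hS ⟨j, hj⟩
    have e1 : ∑ k ∈ Finset.range (j + 1), A k = ∑ k ∈ Finset.range (ℓ + 1), (if k ≤ j then A k else 0) := by
      rw [← Finset.sum_filter]
      congr 1
      ext k
      simp only [Finset.mem_range, Finset.mem_filter]
      omega
    have e2 : ∑ k ∈ Finset.range (ℓ + 1), (if k ≤ j then A k else 0) =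
        ∑ k : Fin (ℓ + 1), (if k ≤ (⟨j, hj⟩ : Fin (ℓ + 1)) then E.aggExp π c (π k) else 0) := by
      rw [← Fin.sum_univ_eq_sum_range (fun k => if k ≤ j then A k else 0)]
      refine Finset.sum_congr rfl fun k _ => ?_
      have hk : (k : ℕ) < ℓ + 1 := k.isLt
      simp only [hA, hk, dif_pos, Fin.eta, Fin.le_def]
    rw [e1, e2]
    exact h
  · -- monotone
    have h1 : k < ℓ + 1 := by omega
    simp only [hy, h1, hk, dif_pos]
    refine Real.log_le_log (hg _) (hs ?_)
    rw [Fin.le_def]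
    simp
  · -- non-positive
    simp only [hy, hk, dif_pos]
    exact Real.log_nonpos (hg _).le (hg1 _)

/-- `Kup ℓ c ≥ 0` (indeed `≥ 1`). -/
theorem Kup_nonneg [Fintype ι] (c : ι → ℝ) : 0 ≤ Kup ℓ c :=
  Finset.prod_nonneg fun _ _ => le_trans zero_le_one (le_max_left _ _)

/-- **Boundedness of `powProd` on the simplex under the run condition**: if `|R| ≤ blockSum E c R` for every run
`R` of consecutive gaps (i.e. `Σ_{span ⊆ R} c_i ≥ 0`), then `powProd E c t ≤ Kup ℓ c` at every point of the open
simplex. -/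
theorem powProd_le_Kup_of_runs [Fintype ι] {c : ι → ℝ}
    (hc : ∀ p q : ℕ, p < q → q ≤ ℓ + 1 → ((q - p : ℕ) : ℝ) ≤ E.blockSum c (gapRun ℓ p q))
    {t : Fin ℓ → ℝ} (ht : t ∈ openSimplex ℓ) : E.powProd c t ≤ Kup ℓ c := by
  classical
  obtain ⟨π, hs⟩ := EdgeFamily.exists_sorted (fun w : Fin (ℓ + 1) => gapN t w)
  have hpos := (mem_openSimplex_iff_gapN t).1 ht
  have hmono : E.aggMono π c (fun w => gapN t w) ≤ 1 := by
    refine E.aggMono_le_one π c hs hpos (fun w => gapN_le_one ht w) fun j => ?_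
    have h := E.psum_aggExp_eq_blockSum π c j
    have hcard := card_lowGaps π j
    have hL := E.card_le_blockSum_of_runs hc _ (lowGaps π j) rfl (Finset.card_pos.1 (by rw [hcard]; omega))
    rw [hcard] at hL
    push_cast at hL
    linarith
  calc E.powProd c t ≤ Kup ℓ c * E.aggMono π c (fun w => gapN t w) := E.powProd_le_aggMono π c ht hs
    _ ≤ Kup ℓ c * 1 := mul_le_mul_of_nonneg_left hmono (Kup_nonneg c)
    _ = Kup ℓ c := mul_one _

/-- The run condition in exponent-sum form: `0 ≤ Σ_{i : span i ⊆ R} c_i` for every run `R`, restated as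
`|R| ≤ blockSum E c R`. -/
theorem card_le_blockSum_iff [Fintype ι] (c : ι → ℝ) (L : Finset (Fin (ℓ + 1))) :
    (L.card : ℝ) ≤ E.blockSum c L ↔ 0 ≤ ∑ i ∈ univ.filter (fun i => E.span i ⊆ L), c i := by
  unfold blockSum
  constructor <;> intro h <;> linarith

end EdgeFamily

end Summit.KontsevichZagierPeriods.Zeta5Search.Families.Cellular
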